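import Literature.IUT.LogVolume.Corollary22PartIILemmas
import Literature.IUT.LogVolume.PrincipalArithmeticDivisors
import Literature.IUT.LogVolume.RArithmeticDivisorsBridge
import HarnessLib

/-!
# [IUTchIV] Cor. 2.2 / Thm. 1.10: the `q`-parameter degree `log(q^{∤S}(λ))` of a point of the `λ`-line is
# independent of the field over which the point is presented — PROVED

Mochizuki, *Inter-universal Teichmüller theory IV*, RIMS manuscript (Apr. 2020; = PRIMS **57** (2021)),
Theorem 1.10, kurims p. 23 (render `paper:url-56bcb0f95768` p0023 l. 61–62): "Here, we observe that the
various `log(q_{(−)})`'s are independent of the choice of `F□`" — `log(q) := deg(𝔮^{F□}_{ADiv})` being the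
NORMALIZED degree of "the effective arithmetic divisor determined by the `q`-parameters of the elliptic curve
`E_F` at the elements of `𝕍(F□)^bad`" (p. 23 l. 6–9), for any number field `F□ ∈ {F, F_tpd, F_mod}` over which
those `q`-parameters are defined; likewise Cor. 2.2 (i), p. 41: "`log(q^∀(−))`, `log(q^{∤2}(−))` … the
normalized degree of the effective arithmetic divisor determined by the `q`-parameters of an elliptic curve
over a number field" as FUNCTIONS on `U_X(ℚ̄)`, i.e. independent of the presenting field.

PROOF-ONLY file (classical; no definitions; TAKES NO SIDE on [IUTchIII] Cor. 3.12 — no Θ-data occur). Two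
presentations `P = (F_tpd, λ)` and `Q = (F, λ)` of the same point of the `λ`-line (the tree's `NFPoint`,
abc-iut-S4) over number fields `F_tpd ⊆ F` — i.e. `Q.x = λ` viewed in `F` (`hx : Q.x = algebraMap P.F Q.F P.x`;
the case `Q = Cor22.extend P F` of abc-iut-S-d2's `Corollary22Legendre.lean` holds with `hx := rfl`) — have
`q`-parameter divisors (abc-iut-S3's `Corollary22Statement.lean`: `Cor22.qDivisor P S = Σ_{v bad, v ∤ S} h_v·[v]`,
`h_v = max(0, −ord_v j(λ))`, `Cor22.logQAvoid P S = deĝ̲(−)` of it) related by PULL-BACK along `F_tpd ⊆ F`,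
because `ord_w(j(λ)) = e_{w|v}·ord_v(j(λ))` (the tree's `ord_algebraMap`, Mathlib `valuation_liesOver`); and the
normalized degree is invariant under pull-back ([IUTchIV] Def. 1.9 (i) "`deg(𝔞|_K) = deg(𝔞)`", the tree's
`ndeg_pullback`, `RArithmeticDivisorsPullback.lean`). Results (hypothesis `hx` throughout):

* `Cor22.jInv_map` — `j(λ) = 2^8(λ²−λ+1)³/(λ²(λ−1)²)` commutes with field homomorphisms;
* `Cor22.ord_jInv_of_algebraMap`, `Cor22.mem_badPlaces_iff_of_algebraMap`, `Cor22.localHeight_of_algebraMap`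
  (`h_w(λ/F) = e_{w|v}·h_v(λ/F_tpd)`; [IUTchIV] p. 45 (P2) / [GenEll] Rem. 3.3.1: local heights scale by the
  ramification index), `Cor22.natCast_mem_finBelow_iff` (`w ∣ p ⟺ v ∣ p` for a rational prime `p`);
* `Cor22.qDivisor_apply` (coefficients of the `q`-parameter divisor);
* **`Cor22.ofFinDivisor_qDivisor_of_algebraMap`**: `𝔮^{F}(λ) = 𝔮^{F_tpd}(λ)|_F` as `ℝ`-arithmetic divisors;
* **`Cor22.logQAvoid_of_algebraMap : logQAvoid Q S = logQAvoid P S`**, `Cor22.logQForall_of_algebraMap`,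
  `Cor22.logQNotTwo_of_algebraMap` — the printed independence of `F□`; `Cor22.logQAvoid_extend` etc. for
  `Q = extend P F`;
* `Cor22.dmod_of_algebraMap : dmod Q = dmod P` (`d_mod = [ℚ(j(λ)):ℚ]` does not see the presentation).

Consumer: the c312 crew's point dictionary (`Summits/ABC/IUTFork/Cor312ProvenancePoint.lean`, seat
abc-iut-c312-8: `log(q)` of an initial Θ-datum over the Legendre curve `E_F` of `λ` equals
`logQAvoid P {2, l}`), and campaign S's `λ`-line ↔ `M_ell` transports. Deliberately NOT here: the
`EllPoint`-level transport (abc-iut-S-d3), `degInf ↔ logQForall` (abc-iut-S-d1), anything about Cor. 3.12.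
-/

noncomputable section

namespace Literature.IUT.LogVolume

namespace Cor22

open NumberField IsDedekindDomain Literature.NumberTheory.DiophantineGeometry.GenEll
open scoped Classical

/-! ## `j(λ)` and field homomorphisms -/

/-- The Legendre `j`-invariant `j(λ) = 2^8·(λ²−λ+1)³/(λ²·(λ−1)²)` ([IUTchIV] p. 41; Silverman AEC III.1.7)
commutes with homomorphisms of fields: `φ(j(λ)) = j(φ(λ))`. [cite: Mochizuki2012, IUTchIV Cor 2.2 (i) p.41] -/
theorem jInv_map {K L : Type*} [Field K] [Field L] (φ : K →+* L) (t : K) : φ (jInv t) = jInv (φ t) := by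
  simp only [jInv, map_div₀, map_mul, map_pow, map_sub, map_add, map_one, map_ofNat]

variable {P Q : NFPoint} [Algebra P.F Q.F] (hx : Q.x = algebraMap P.F Q.F P.x)
include hx

/-- `j(λ)` of the point presented over `F` is `j(λ)` viewed in `F`. [cite: Mochizuki2012, IUTchIV Cor 2.2 (ii) p.42] -/
theorem jInv_of_algebraMap : jInv Q.x = algebraMap P.F Q.F (jInv P.x) := by
  rw [hx, jInv_map]

/-! ## Local heights under extension of the presenting field -/

/-- `ord_w(j(λ)) = e_{w|v}·ord_v(j(λ))` for a finite place `w` of `F` over the place `v` of `F_tpd` (the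
tree's `ord_algebraMap`; Mathlib `valuation_liesOver`). [cite: Mochizuki2012, IUTchIV Cor 2.2 proof (P2) p.45] -/
theorem ord_jInv_of_algebraMap (w : HeightOneSpectrum (𝓞 Q.F)) :
    ord Q.F w (jInv Q.x) =
      Ideal.ramificationIdx' (finBelow P.F Q.F w).asIdeal w.asIdeal * ord P.F (finBelow P.F Q.F w) (jInv P.x) := by
  rw [jInv_of_algebraMap hx, ord_algebraMap]

omit hx in
/-- The ramification index `e_{w|v} ≥ 1` of a finite place over the place under it (Mathlib).
[cite: Mochizuki2012, IUTchIV Def 1.9 (i) p.22] -/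
theorem ramificationIdx'_finBelow_pos (w : HeightOneSpectrum (𝓞 Q.F)) :
    0 < Ideal.ramificationIdx' (finBelow P.F Q.F w).asIdeal w.asIdeal :=
  Nat.pos_of_ne_zero
    (Ideal.IsDedekindDomain.ramificationIdx'_ne_zero_of_liesOver w.asIdeal (finBelow P.F Q.F w).ne_bot)

/-- A finite place `w` of `F` is a bad place of `λ/F` (a pole of `j(λ)`) iff the place `v` of `F_tpd` under
it is a bad place of `λ/F_tpd` (`ord_w = e_{w|v}·ord_v` with `e_{w|v} ≥ 1`). [cite: Mochizuki2012, IUTchIV Cor 2.2 proof p.44] -/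
theorem mem_badPlaces_iff_of_algebraMap (w : HeightOneSpectrum (𝓞 Q.F)) :
    w ∈ badPlaces Q ↔ finBelow P.F Q.F w ∈ badPlaces P := by
  rw [mem_badPlaces_iff_ord_neg, mem_badPlaces_iff_ord_neg, ord_jInv_of_algebraMap hx]
  have he : (0 : ℤ) < Ideal.ramificationIdx' (finBelow P.F Q.F w).asIdeal w.asIdeal := by
    exact_mod_cast ramificationIdx'_finBelow_pos (P := P) w
  constructor
  · intro h
    by_contra hge
    exact absurd h (not_lt.mpr (mul_nonneg he.le (not_lt.mp hge)))
  · intro h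
    exact mul_neg_of_pos_of_neg he h

/-- **`h_w(λ/F) = e_{w|v}·h_v(λ/F_tpd)`**: the local height `max(0, −ord(j(λ)))` at a finite place `w` of
`F` is the ramification index times the local height at the place of `F_tpd` under `w` ([IUTchIV] p. 45
(P2) / [GenEll] Rem. 3.3.1: the orders of the `q`-parameters over an extension get multiplied by
ramification indices). [cite: Mochizuki2012, IUTchIV Cor 2.2 proof (P2) p.45] -/
theorem localHeight_of_algebraMap (w : HeightOneSpectrum (𝓞 Q.F)) :
    localHeight Q w =
      (Ideal.ramificationIdx' (finBelow P.F Q.F w).asIdeal w.asIdeal : ℝ) * localHeight P (finBelow P.F Q.F w) := by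
  unfold localHeight
  rw [ord_jInv_of_algebraMap hx]
  set e : ℕ := Ideal.ramificationIdx' (finBelow P.F Q.F w).asIdeal w.asIdeal with he
  set m : ℤ := ord P.F (finBelow P.F Q.F w) (jInv P.x) with hm
  rcases le_or_gt m 0 with hle | hlt
  · -- `−m ≥ 0`: both sides are `e·(−m)`
    obtain ⟨n, hn⟩ := Int.eq_ofNat_of_zero_le (neg_nonneg.mpr hle)
    have h1 : -((e : ℤ) * m) = ((e * n : ℕ) : ℤ) := by push_cast; rw [← hn]; ring
    rw [h1, hn, Int.toNat_natCast, Int.toNat_natCast]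
    push_cast
    ring
  · -- `m > 0`: both sides vanish
    have h1 : (-((e : ℤ) * m)).toNat = 0 := Int.toNat_eq_zero.mpr (by nlinarith)
    have h2 : (-m).toNat = 0 := Int.toNat_eq_zero.mpr (by omega)
    rw [h1, h2]
    simp

omit hx in
/-- For a natural number `p` (a rational prime in the applications): `p ∈ v` for the place `v` of `F_tpd`
under the place `w` of `F` (`v = w ∩ 𝓞_{F_tpd}`) iff `p ∈ w`. Used for the conditions "`v ∤ 2`", "`v ∤ l`"
of `log(q^{∤S})`. [cite: Mochizuki2012, IUTchIV Cor 2.2 (i) p.41] -/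
theorem natCast_mem_finBelow_iff (w : HeightOneSpectrum (𝓞 Q.F)) (p : ℕ) :
    ((p : ℕ) : 𝓞 P.F) ∈ (finBelow P.F Q.F w).asIdeal ↔ ((p : ℕ) : 𝓞 Q.F) ∈ w.asIdeal := by
  change ((p : ℕ) : 𝓞 P.F) ∈ Ideal.comap (algebraMap (𝓞 P.F) (𝓞 Q.F)) w.asIdeal ↔ _
  rw [Ideal.mem_comap, map_natCast]

/-! ## The `q`-parameter divisor pulls back -/

omit hx in
/-- Coefficients of the `q`-parameter divisor away from `S`: `h_v` at a bad place `v` not dividing any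
prime of `S`, `0` elsewhere. [cite: Mochizuki2012, IUTchIV Cor 2.2 (i) p.41] -/
theorem qDivisor_apply (Q : NFPoint) (S : Finset ℕ) (v : HeightOneSpectrum (𝓞 Q.F)) :
    qDivisor Q S v =
      if v ∈ badPlaces Q ∧ ∀ p ∈ S, ((p : ℕ) : 𝓞 Q.F) ∉ v.asIdeal then localHeight Q v else 0 := by
  unfold qDivisor
  rw [Finset.sum_apply']
  simp only [FinDivisor.of, Finsupp.single_apply]
  rw [Finset.sum_ite_eq']
  simp only [Finset.mem_filter]

/-- **`𝔮^{F}_{∤S}(λ) = 𝔮^{F_tpd}_{∤S}(λ)|_F`**: as `ℝ`-arithmetic divisors on `F` ([IUTchIV] Def. 1.9 (i): the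
pull-back `𝔞|_F = Σ_w e_{w|v}·c_{v(w)}·w`), the `q`-parameter divisor of `λ` presented over `F` is the
pull-back of the one over `F_tpd` — coefficientwise `h_w = e_{w|v}·h_v`, with the same bad places and the
same divisibility conditions. [cite: Mochizuki2012, IUTchIV Thm 1.10 p.23] -/
theorem ofFinDivisor_qDivisor_of_algebraMap (S : Finset ℕ) :
    ADivisor.ofFinDivisor Q.F (qDivisor Q S) = (ADivisor.ofFinDivisor P.F (qDivisor P S)).pullback P.F Q.F := by
  ext w
  rcases w with w | w
  · -- archimedean places carry no `q`-parameter contribution on either side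
    rw [ADivisor.ofFinDivisor_apply_inl, ADivisor.pullback_apply]
    change (0 : ℝ) = _ * ADivisor.ofFinDivisor P.F (qDivisor P S) (Sum.inl (w.comap (algebraMap P.F Q.F)))
    rw [ADivisor.ofFinDivisor_apply_inl, mul_zero]
  · rw [ADivisor.pullback_apply]
    change ADivisor.ofFinDivisor Q.F (qDivisor Q S) (Sum.inr w) =
      _ * ADivisor.ofFinDivisor P.F (qDivisor P S) (Sum.inr (finBelow P.F Q.F w))
    rw [ADivisor.ofFinDivisor_apply_inr, ADivisor.ofFinDivisor_apply_inr, qDivisor_apply, qDivisor_apply]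
    have he : (pullbackWeight P.F Q.F (Sum.inr w) : ℝ) =
        (Ideal.ramificationIdx' (finBelow P.F Q.F w).asIdeal w.asIdeal : ℝ) := rfl
    by_cases hw : w ∈ badPlaces Q ∧ ∀ p ∈ S, ((p : ℕ) : 𝓞 Q.F) ∉ w.asIdeal
    · have hv : finBelow P.F Q.F w ∈ badPlaces P ∧
          ∀ p ∈ S, ((p : ℕ) : 𝓞 P.F) ∉ (finBelow P.F Q.F w).asIdeal :=
        ⟨(mem_badPlaces_iff_of_algebraMap hx w).mp hw.1,
          fun p hp => by rw [natCast_mem_finBelow_iff]; exact hw.2 p hp⟩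
      rw [if_pos hw, if_pos hv, localHeight_of_algebraMap hx, he]
    · have hv : ¬ (finBelow P.F Q.F w ∈ badPlaces P ∧
          ∀ p ∈ S, ((p : ℕ) : 𝓞 P.F) ∉ (finBelow P.F Q.F w).asIdeal) := fun h =>
        hw ⟨(mem_badPlaces_iff_of_algebraMap hx w).mpr h.1,
          fun p hp => by rw [← natCast_mem_finBelow_iff (P := P)]; exact h.2 p hp⟩
      rw [if_neg hw, if_neg hv, mul_zero]

/-! ## Independence of the presenting field -/

/-- **`log(q^{∤S}(λ))` does not depend on the field over which `λ` is presented** ([IUTchIV] Thm. 1.10, p. 23: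
"the various `log(q_{(−)})`'s are independent of the choice of `F□`"; Cor. 2.2 (i) p. 41): for `λ` presented over
`F_tpd` (`P`) and over a finite extension `F ⊇ F_tpd` (`Q`, `Q.x = λ`), `logQAvoid Q S = logQAvoid P S`. PROVED:
`𝔮^F = 𝔮^{F_tpd}|_F` (`ofFinDivisor_qDivisor_of_algebraMap`) and `deg(𝔞|_F) = deg(𝔞)` (Def. 1.9 (i),
`ndeg_pullback`). [cite: Mochizuki2012, IUTchIV Thm 1.10 p.23] -/
theorem logQAvoid_of_algebraMap (S : Finset ℕ) : logQAvoid Q S = logQAvoid P S := by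
  unfold logQAvoid
  rw [← ndeg_ofFinDivisor, ← ndeg_ofFinDivisor, ofFinDivisor_qDivisor_of_algebraMap hx, ndeg_pullback]

/-- `log(q^∀(λ))` is independent of the presenting field. [cite: Mochizuki2012, IUTchIV Cor 2.2 (i) p.41] -/
theorem logQForall_of_algebraMap : logQForall Q = logQForall P :=
  logQAvoid_of_algebraMap hx ∅

/-- `log(q^{∤2}(λ))` is independent of the presenting field. [cite: Mochizuki2012, IUTchIV Cor 2.2 (i) p.41] -/
theorem logQNotTwo_of_algebraMap : logQNotTwo Q = logQNotTwo P :=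
  logQAvoid_of_algebraMap hx {2}

/-! ## `d_mod` under extension of the presenting field -/

/-- **`d_mod = [F_mod : ℚ] = [ℚ(j(λ)) : ℚ]`** ([IUTchIV] Thm. 1.10 p. 22; abc-iut-S-d2's `Cor22.dmod`) does not
depend on the field over which `λ` is presented: `ℚ(j(λ)) ⊆ F_tpd` and `ℚ(j(λ)) ⊆ F` have the same degree,
the degree of the minimal polynomial of `j(λ)` over `ℚ`. [cite: Mochizuki2012, IUTchIV Thm 1.10 p.22] -/
theorem dmod_of_algebraMap : dmod Q = dmod P := by
  unfold dmod
  rw [jInv_of_algebraMap hx]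
  have hint : IsIntegral ℚ (jInv P.x) := Algebra.IsIntegral.isIntegral (jInv P.x)
  have hint' : IsIntegral ℚ (algebraMap P.F Q.F (jInv P.x)) := hint.map (IsScalarTower.toAlgHom ℚ P.F Q.F)
  rw [IntermediateField.adjoin.finrank hint, IntermediateField.adjoin.finrank hint',
    minpoly.algebraMap_eq (algebraMap P.F Q.F).injective]

/-! ## The case `Q = extend P F` -/

omit hx

variable (P) (F : Type) [Field F] [NumberField F] [Algebra P.F F]

/-- `log(q^{∤S}(λ))` of abc-iut-S-d2's extended point `Cor22.extend P F` (`λ ∈ U_X(F_tpd) ⊆ U_X(F)`) equals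
that of `P`. [cite: Mochizuki2012, IUTchIV Thm 1.10 p.23] -/
theorem logQAvoid_extend (S : Finset ℕ) : logQAvoid (extend P F) S = logQAvoid P S :=
  letI : Algebra P.F (extend P F).F := ‹Algebra P.F F›
  logQAvoid_of_algebraMap (P := P) (Q := extend P F) rfl S

/-- `log(q^∀(λ))` of the extended point equals that of `P`. [cite: Mochizuki2012, IUTchIV Cor 2.2 (i) p.41] -/
theorem logQForall_extend : logQForall (extend P F) = logQForall P :=
  logQAvoid_extend P F ∅

/-- `log(q^{∤2}(λ))` of the extended point equals that of `P`. [cite: Mochizuki2012, IUTchIV Cor 2.2 (i) p.41] -/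
theorem logQNotTwo_extend : logQNotTwo (extend P F) = logQNotTwo P :=
  logQAvoid_extend P F {2}

/-- `d_mod` of the extended point equals that of `P`. [cite: Mochizuki2012, IUTchIV Thm 1.10 p.22] -/
theorem dmod_extend : dmod (extend P F) = dmod P :=
  letI : Algebra P.F (extend P F).F := ‹Algebra P.F F›
  dmod_of_algebraMap (P := P) (Q := extend P F) rfl

end Cor22

end Literature.IUT.LogVolume

end
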